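import Summits.KontsevichZagierPeriods.Zeta5Search.LaiSweepShard

/-!
# `κ₃` sweep certificate — shard file 098 of 127 (shards 686–692 of 889)

HONEST FRAMING. Systematic search; no irrationality claim unless certified. This file only checks,
by `decide +kernel`, shards 686–692 of the order-cell sweep of the `κ₃` point `(74, 2180, 444; δ74)`
(engine `LaiSweepEngine`, soundness `LaiSweepJump/Free/Eval/Shard/Kappa3`; a shard is `⟨regime, n,
p, q, p', q', Lo, Up⟩`: `n` cells from `p/q` to `p'/q'` with integer rate sums in `[Lo, Up]`, `K =
128`, `D = 2^40`). It draws NO conclusion: only the capstone `LaiKappa3SweepCert`, which needs all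
127 shard files, does. Kernel cost of this file ≈ 560 cells × 0.3 s.
-/

namespace Summit.KontsevichZagierPeriods.Zeta5Search.Sweep

set_option maxHeartbeats 100000000 in
/-- Shard 686: 80 cells of regime B from `149/200` to `247/331`.
[cite: Lai2024BallRivoal, §4 Lemma 4.3] -/
theorem shard686 :
    Shard.check 128 (2^40)
      ⟨true, 80, 149, 200, 247, 331, 11270637628584, 16740730547188⟩ = true := by
  decide +kernel

set_option maxHeartbeats 100000000 in
/-- Shard 687: 80 cells of regime B from `247/331` to `74/99`.
[cite: Lai2024BallRivoal, §4 Lemma 4.3] -/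
theorem shard687 :
    Shard.check 128 (2^40)
      ⟨true, 80, 247, 331, 74, 99, 11532503993372, 17147448055156⟩ = true := by
  decide +kernel

set_option maxHeartbeats 100000000 in
/-- Shard 688: 80 cells of regime B from `74/99` to `143/191`.
[cite: Lai2024BallRivoal, §4 Lemma 4.3] -/
theorem shard688 :
    Shard.check 128 (2^40)
      ⟨true, 80, 74, 99, 143, 191, 11199131443188, 16668941560337⟩ = true := by
  decide +kernel

set_option maxHeartbeats 100000000 in
/-- Shard 689: 80 cells of regime B from `143/191` to `325/433`.
[cite: Lai2024BallRivoal, §4 Lemma 4.3] -/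
theorem shard689 :
    Shard.check 128 (2^40)
      ⟨true, 80, 143, 191, 325, 433, 17293625121259, 25775234474604⟩ = true := by
  decide +kernel

set_option maxHeartbeats 100000000 in
/-- Shard 690: 80 cells of regime B from `325/433` to `263/350`.
[cite: Lai2024BallRivoal, §4 Lemma 4.3] -/
theorem shard690 :
    Shard.check 128 (2^40)
      ⟨true, 80, 325, 433, 263, 350, 7817737256583, 11664491840204⟩ = true := by
  decide +kernel

set_option maxHeartbeats 100000000 in
/-- Shard 691: 80 cells of regime B from `263/350` to `213/283`.
[cite: Lai2024BallRivoal, §4 Lemma 4.3] -/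
theorem shard691 :
    Shard.check 128 (2^40)
      ⟨true, 80, 263, 350, 213, 283, 11181802129311, 16698385643270⟩ = true := by
  decide +kernel

set_option maxHeartbeats 100000000 in
/-- Shard 692: 80 cells of regime B from `213/283` to `193/256`.
[cite: Lai2024BallRivoal, §4 Lemma 4.3] -/
theorem shard692 :
    Shard.check 128 (2^40)
      ⟨true, 80, 213, 283, 193, 256, 11510574767689, 17207261403195⟩ = true := by
  decide +kernel

/-- The checked shards of this file, in order. [folklore] -/
def shards098 : List (CheckedShard 128 (2^40)) :=
  [⟨_, shard686⟩, ⟨_, shard687⟩, ⟨_, shard688⟩, ⟨_, shard689⟩, ⟨_, shard690⟩,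
    ⟨_, shard691⟩, ⟨_, shard692⟩]

end Summit.KontsevichZagierPeriods.Zeta5Search.Sweep
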